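import Literature.Probability.Percolation.LongRangeKernelPercolation
import HarnessLib

/-!
# `L`-adic hierarchical decompositions of `ℤ^d`: blocks, levels, kernels (Hutchcroft 2022, §2.1)

Topic `Literature/Probability/Percolation`. The combinatorial skeleton of Hutchcroft's proof of the
hierarchical two-point bound (J. Math. Phys. 63 (2022), §2.1 "The hierarchical decomposition"),
for the named fact `Hutchcroft2022_twoPoint_volumeTail` of `LongRangeKernelPercolation.lean`.

An `L`-adic decomposition is encoded by a compatible offset system `o` (`IsHierOffset L o`:
`o n ∈ [0,L^n)^d`, `o (n+1) ≡ o n mod L^n`); Hutchcroft's digit sequences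
`σ ∈ Σ = ({0,…,L-1}^d)^ℕ` are the same data (offsets = partial sums of digits). With this encoding
the translation `σ + x` of (2.2) is coordinatewise addition mod `L^n` (`shiftOffset`).

* `blockIdx`, `block L o n x` (`B^σ_n(x)`, a lattice cube of side `L^n`), `mem_block_iff`,
  partition / equal-or-disjoint, `card_block` (`L^{dn}`), `block_zero` (singletons),
  `block_subset_block_succ`, `block_mono`, `block_subset_or_disjoint` (nested or disjoint),
  `children` and `card_children` (`L^d` children), `abs_sub_lt_of_mem_block`;
* `HasCommonBlock`, `hLevel` (`h_σ(x,y)`), `mem_block_iff_hLevel_le`, `hLevel_comm`,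
  `one_le_hLevel`, `dist_lt_pow_hLevel` (`‖x-y‖_∞ < L^{h_σ(x,y)} = d_σ(x,y)`);
* `shiftOffset` (`σ + t`), `IsHierOffset.shift`, `mem_block_shift_iff`, `block_shift_eq_image`
  ((2.2)), `hLevel_shift` ((2.3));
* `hierKernel` (`H_σ`), `hierKernel_mk`, `hierKernel_le` (`H_σ ≤ J` under
  `J ≥ c‖x-y‖^{-d-α}`), `remKernel` (`R_σ = J - H_σ ≥ 0`), `blockKernel` (`H_B`),
  `blockKernel_eq_hierKernel` / `blockKernel_eq_zero_of_ne` (`H_σ = Σ_B H_B` edge by edge),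
  `blockKernel_le` (`H_B ≤ cL^{-(d+α)n}`).

## References

* [Hutchcroft2022] T. Hutchcroft, *Sharp hierarchical upper bounds on the critical two-point
  function for long-range percolation on `ℤ^d`*, J. Math. Phys. 63 (2022), arXiv:2202.07634,
  §2.1 (pp. 6–7): blocks, `h_σ`, `d_σ`, `H_σ`, `R_σ`, `H_B`, (2.2)–(2.3).
-/

noncomputable section

namespace Literature.Probability.Percolation

open Finset Literature.Probability.LatticeModels

variable {d : ℕ}

/-! ### Hierarchical offset systems -/

/-- An **`L`-adic hierarchical decomposition of `ℤ^d`**, encoded by its compatible system of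
offsets: `o n ∈ [0, L^n)^d` is the corner, modulo `L^n`, of the level-`n` blocks, and
`o (n+1) ≡ o n (mod L^n)`. Hutchcroft parametrises the same decompositions by digit sequences
`σ ∈ Σ = ({0,…,L-1}^d)^ℕ` ("Each sequence `σ` … determines an `L`-adic hierarchical decomposition of
`ℤ^d` … an `n`-block [is] a set of the form `ℤ^d ∩ (Σ_m σ_{m,i} L^m + ∏_i [k_i L^n, (k_i+1)L^n - 1])`");
the offsets are the partial sums of the digits, and the offset form makes the translations
`σ + x` of (2.2) the coordinatewise addition modulo `L^n`. [cite: Hutchcroft2022, §2.1 (p. 6)] -/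
def IsHierOffset (L : ℕ) (o : ℕ → Site d) : Prop :=
  ∀ n i, 0 ≤ o n i ∧ o n i < (L : ℤ) ^ n ∧ o (n + 1) i % (L : ℤ) ^ n = o n i

namespace IsHierOffset

variable {L : ℕ} {o : ℕ → Site d}

/-- Offsets are nonnegative. [folklore] -/
theorem nonneg (h : IsHierOffset L o) (n : ℕ) (i : Fin d) : 0 ≤ o n i := (h n i).1

/-- Offsets are `< L^n`. [folklore] -/
theorem lt (h : IsHierOffset L o) (n : ℕ) (i : Fin d) : o n i < (L : ℤ) ^ n := (h n i).2.1

/-- Compatibility of consecutive offsets. [folklore] -/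
theorem succ_emod (h : IsHierOffset L o) (n : ℕ) (i : Fin d) : o (n + 1) i % (L : ℤ) ^ n = o n i :=
  (h n i).2.2

/-- At level `0` the offset vanishes. [folklore] -/
theorem zero_eq (h : IsHierOffset L o) (i : Fin d) : o 0 i = 0 := by
  have h0 := h.nonneg 0 i
  have h1 := h.lt 0 i
  simp at h1
  omega

end IsHierOffset

/-- The zero offset system (the standard `L`-adic decomposition, Hutchcroft's all-zero sequence).
[cite: Hutchcroft2022, §2.1 (p. 6)] -/
theorem isHierOffset_zero (L : ℕ) (hL : 1 ≤ L) : IsHierOffset (d := d) L fun _ => 0 := by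
  intro n i
  refine ⟨le_rfl, by positivity, by simp⟩

/-! ### Blocks -/

/-- The **level-`n` block index** of `x`: `k_i = ⌊(x_i - o_{n,i}) / L^n⌋`.
[cite: Hutchcroft2022, §2.1 (p. 6)] -/
def blockIdx (L : ℕ) (o : ℕ → Site d) (n : ℕ) (x : Site d) : Site d :=
  fun i => (x i - o n i) / (L : ℤ) ^ n

/-- **The `n`-block `B^σ_n(x)` containing `x`**: all `y` with the same level-`n` block index,
i.e. the lattice cube `o_n + L^n k + [0, L^n)^d`. [cite: Hutchcroft2022, §2.1 (p. 6, B_n^σ(x))] -/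
def block (L : ℕ) (o : ℕ → Site d) (n : ℕ) (x : Site d) : Finset (Site d) :=
  (Fintype.piFinset fun _ : Fin d => Finset.range (L ^ n)).image
    fun r : Fin d → ℕ => fun i => o n i + blockIdx L o n x i * (L : ℤ) ^ n + (r i : ℤ)

section Blocks

variable {L : ℕ} (hL : 1 ≤ L) (o : ℕ → Site d)
include hL

/-- `L^n > 0`. [folklore] -/
private theorem Lpow_pos (n : ℕ) : (0 : ℤ) < (L : ℤ) ^ n := by
  have : (0 : ℤ) < L := by exact_mod_cast hL
  positivity

/-- **Membership in a block**: `y ∈ B_n(x)` iff `y` and `x` have the same level-`n` block index.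
[cite: Hutchcroft2022, §2.1 (p. 6)] -/
theorem mem_block_iff {n : ℕ} {x y : Site d} :
    y ∈ block L o n x ↔ blockIdx L o n y = blockIdx L o n x := by
  have hpos := Lpow_pos hL n
  simp only [block, Finset.mem_image, Fintype.mem_piFinset, Finset.mem_range]
  constructor
  · rintro ⟨r, hr, rfl⟩
    funext i
    show (o n i + blockIdx L o n x i * (L : ℤ) ^ n + (r i : ℤ) - o n i) / (L : ℤ) ^ n =
      blockIdx L o n x i
    have : (o n i + blockIdx L o n x i * (L : ℤ) ^ n + (r i : ℤ) - o n i) =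
        (r i : ℤ) + blockIdx L o n x i * (L : ℤ) ^ n := by ring
    rw [this, Int.add_mul_ediv_right _ _ hpos.ne', Int.ediv_eq_zero_of_lt (by positivity)
      (by exact_mod_cast hr i), zero_add]
  · intro h
    refine ⟨fun i => ((y i - o n i) % (L : ℤ) ^ n).toNat, fun i => ?_, ?_⟩
    · have h1 := Int.emod_nonneg (y i - o n i) hpos.ne'
      have h2 := Int.emod_lt_of_pos (y i - o n i) hpos
      have : (((y i - o n i) % (L : ℤ) ^ n).toNat : ℤ) < (L : ℤ) ^ n := by
        rw [Int.toNat_of_nonneg h1]; exact h2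
      exact_mod_cast this
    · funext i
      have h1 := Int.emod_nonneg (y i - o n i) hpos.ne'
      rw [Int.toNat_of_nonneg h1]
      have hidx : blockIdx L o n x i = (y i - o n i) / (L : ℤ) ^ n := by
        rw [← h]; rfl
      rw [hidx]
      have := Int.mul_ediv_add_emod (y i - o n i) ((L : ℤ) ^ n)
      linarith [mul_comm ((L : ℤ) ^ n) ((y i - o n i) / (L : ℤ) ^ n)]

/-- `x ∈ B_n(x)`. [cite: Hutchcroft2022, §2.1 (p. 6)] -/
theorem mem_block_self (n : ℕ) (x : Site d) : x ∈ block L o n x :=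
  (mem_block_iff hL o).2 rfl

/-- **The `n`-blocks partition `ℤ^d`**: `B_n(y) = B_n(x)` iff `y ∈ B_n(x)`. [cite: Hutchcroft2022, §2.1 (p. 6)] -/
theorem block_eq_iff_mem {n : ℕ} {x y : Site d} : block L o n y = block L o n x ↔ y ∈ block L o n x := by
  constructor
  · intro h; rw [← h]; exact mem_block_self hL o n y
  · intro h
    rw [mem_block_iff hL o] at h
    ext z
    rw [mem_block_iff hL o, mem_block_iff hL o, h]

/-- Blocks of one level are equal or disjoint. [cite: Hutchcroft2022, §2.1 (p. 6)] -/
theorem block_eq_or_disjoint (n : ℕ) (x y : Site d) :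
    block L o n x = block L o n y ∨ Disjoint (block L o n x) (block L o n y) := by
  by_cases h : Disjoint (block L o n x) (block L o n y)
  · exact Or.inr h
  · left
    obtain ⟨z, hzx, hzy⟩ := Finset.not_disjoint_iff.1 h
    rw [← (block_eq_iff_mem hL o).2 hzx, ← (block_eq_iff_mem hL o).2 hzy]

/-- Coordinates of the points of a block: `o_{n,i} + k_i L^n ≤ y_i < o_{n,i} + (k_i + 1) L^n`.
[cite: Hutchcroft2022, §2.1 (p. 6)] -/
theorem coord_bounds_of_mem_block {n : ℕ} {x y : Site d} (hy : y ∈ block L o n x) (i : Fin d) :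
    o n i + blockIdx L o n x i * (L : ℤ) ^ n ≤ y i ∧
      y i < o n i + (blockIdx L o n x i + 1) * (L : ℤ) ^ n := by
  have hpos := Lpow_pos hL n
  rw [mem_block_iff hL o] at hy
  have hidx : blockIdx L o n x i = (y i - o n i) / (L : ℤ) ^ n := by rw [← hy]; rfl
  rw [hidx]
  have h1 := Int.mul_ediv_add_emod (y i - o n i) ((L : ℤ) ^ n)
  have h2 := Int.emod_nonneg (y i - o n i) hpos.ne'
  have h3 := Int.emod_lt_of_pos (y i - o n i) hpos
  constructor <;> nlinarith [mul_comm ((L : ℤ) ^ n) ((y i - o n i) / (L : ℤ) ^ n)]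

/-- **Blocks are sup-norm balls of radius `< L^n`**: `y ∈ B_n(x) ⇒ |x_i - y_i| < L^n`, so that the
hierarchical ultrametric dominates `‖·‖_∞` ("`d_σ(x,y) ≥ ‖x-y‖`"). [cite: Hutchcroft2022, §2.1 (p. 6)] -/
theorem abs_sub_lt_of_mem_block {n : ℕ} {x y : Site d} (hy : y ∈ block L o n x) (i : Fin d) :
    |x i - y i| < (L : ℤ) ^ n := by
  have hx := coord_bounds_of_mem_block hL o (mem_block_self hL o n x) i
  have hy' := coord_bounds_of_mem_block hL o hy i
  rw [abs_sub_lt_iff]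
  constructor <;> nlinarith

omit hL in
/-- **`|B_n(x)| = L^{dn}`**. [cite: Hutchcroft2022, §2.1 (p. 6)] -/
theorem card_block (n : ℕ) (x : Site d) : (block L o n x).card = (L ^ n) ^ d := by
  rw [block, Finset.card_image_of_injective, Fintype.card_piFinset]
  · simp
  · intro r r' h
    funext i
    have := congr_fun h i
    simp only [add_right_inj, Nat.cast_inj] at this
    exact this

/-- At level `0` the blocks are singletons ("`0`-blocks are simply singleton sets").
[cite: Hutchcroft2022, §2.1 (p. 6)] -/
theorem block_zero (x : Site d) : block L o 0 x = {x} := by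
  symm
  refine Finset.eq_of_subset_of_card_le (Finset.singleton_subset_iff.2 (mem_block_self hL o 0 x)) ?_
  rw [card_block o, Finset.card_singleton]
  simp

/-- **Nestedness**: `B_n(x) ⊆ B_{n+1}(x)` (each `(n+1)`-block decomposes into `n`-blocks).
[cite: Hutchcroft2022, §2.1 (p. 6)] -/
theorem block_subset_block_succ (ho : IsHierOffset L o) (n : ℕ) (x : Site d) :
    block L o n x ⊆ block L o (n + 1) x := by
  intro y hy
  rw [mem_block_iff hL o] at hy ⊢
  funext i
  have hpos := Lpow_pos hL n
  have hL0 : (0 : ℤ) < L := by exact_mod_cast hL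
  -- `o_{n+1} = o_n + t L^n`
  obtain ⟨t, ht⟩ : ∃ t : ℤ, o (n + 1) i = o n i + t * (L : ℤ) ^ n := by
    refine ⟨o (n + 1) i / (L : ℤ) ^ n, ?_⟩
    have h1 := Int.mul_ediv_add_emod (o (n + 1) i) ((L : ℤ) ^ n)
    rw [ho.succ_emod] at h1
    linarith [mul_comm ((L : ℤ) ^ n) (o (n + 1) i / (L : ℤ) ^ n)]
  have key : ∀ z : Site d, blockIdx L o (n + 1) z i = (blockIdx L o n z i - t) / (L : ℤ) := by
    intro z
    simp only [blockIdx]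
    rw [pow_succ, ← Int.ediv_ediv_of_nonneg hpos.le, ht]
    congr 1
    have : z i - (o n i + t * (L : ℤ) ^ n) = (z i - o n i) + (-t) * (L : ℤ) ^ n := by ring
    rw [this, Int.add_mul_ediv_right _ _ hpos.ne']
    ring
  rw [key, key, show blockIdx L o n y i = blockIdx L o n x i from congr_fun hy i]

/-- `B_m(x) ⊆ B_n(x)` for `m ≤ n`. [cite: Hutchcroft2022, §2.1 (p. 6)] -/
theorem block_mono (ho : IsHierOffset L o) {m n : ℕ} (hmn : m ≤ n) (x : Site d) :
    block L o m x ⊆ block L o n x := by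
  induction hmn with
  | refl => exact Finset.Subset.refl _
  | step _ ih => exact ih.trans (block_subset_block_succ hL o ho _ x)

/-- **Blocks are nested or disjoint**: for `m ≤ n`, `B_m(y) ⊆ B_n(x)` or they are disjoint.
[cite: Hutchcroft2022, §2.1 (p. 6, ancestors and descendants)] -/
theorem block_subset_or_disjoint (ho : IsHierOffset L o) {m n : ℕ} (hmn : m ≤ n) (x y : Site d) :
    block L o m y ⊆ block L o n x ∨ Disjoint (block L o m y) (block L o n x) := by
  by_cases h : Disjoint (block L o m y) (block L o n x)
  · exact Or.inr h
  · left
    obtain ⟨z, hzy, hzx⟩ := Finset.not_disjoint_iff.1 h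
    rw [← (block_eq_iff_mem hL o).2 hzy, ← (block_eq_iff_mem hL o).2 hzx]
    exact block_mono hL o ho hmn z

/-- **The children of a block**: the `n`-blocks contained in the `(n+1)`-block of `x`.
[cite: Hutchcroft2022, §2.1 (p. 6, "children of the block")] -/
def children (L : ℕ) (o : ℕ → Site d) (n : ℕ) (x : Site d) : Finset (Finset (Site d)) :=
  (block L o (n + 1) x).image (block L o n)

omit hL in
/-- Membership in `children`. [folklore] -/
theorem mem_children_iff {n : ℕ} {x : Site d} {C : Finset (Site d)} :
    C ∈ children L o n x ↔ ∃ y ∈ block L o (n + 1) x, block L o n y = C := by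
  rw [children, Finset.mem_image]

/-- A child is contained in its parent. [cite: Hutchcroft2022, §2.1 (p. 6)] -/
theorem subset_of_mem_children (ho : IsHierOffset L o) {n : ℕ} {x : Site d} {C : Finset (Site d)}
    (hC : C ∈ children L o n x) : C ⊆ block L o (n + 1) x := by
  obtain ⟨y, hy, rfl⟩ := (mem_children_iff o).1 hC
  rw [← (block_eq_iff_mem hL o).2 hy]
  exact block_subset_block_succ hL o ho n y

/-- The children are pairwise disjoint. [folklore] -/
theorem pairwiseDisjoint_children (n : ℕ) (x : Site d) :
    (↑(children L o n x) : Set (Finset (Site d))).PairwiseDisjoint id := by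
  intro C hC C' hC' hne
  obtain ⟨y, -, rfl⟩ := (mem_children_iff o).1 hC
  obtain ⟨y', -, rfl⟩ := (mem_children_iff o).1 hC'
  rcases block_eq_or_disjoint hL o n y y' with h | h
  · exact absurd h hne
  · exact h

/-- **Every block has exactly `L^d` children** ("every `n`-block decomposes into exactly `L^d`
`(n-1)`-blocks"). [cite: Hutchcroft2022, §2.1 (p. 6)] -/
theorem card_children (ho : IsHierOffset L o) (n : ℕ) (x : Site d) :
    (children L o n x).card = L ^ d := by
  -- count the points of the parent along its partition into children
  have hcover : (children L o n x).biUnion id = block L o (n + 1) x := by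
    ext y
    simp only [Finset.mem_biUnion, id, mem_children_iff]
    constructor
    · rintro ⟨C, ⟨z, hz, rfl⟩, hyC⟩
      exact (subset_of_mem_children hL o ho ((mem_children_iff o).2 ⟨z, hz, rfl⟩)) hyC
    · intro hy
      exact ⟨block L o n y, ⟨y, hy, rfl⟩, mem_block_self hL o n y⟩
  have hsum := Finset.card_biUnion (pairwiseDisjoint_children hL o n x)
  rw [hcover, card_block o] at hsum
  have hconst : ∑ C ∈ children L o n x, (id C).card = (children L o n x).card * (L ^ n) ^ d := by
    rw [Finset.sum_const_nat fun C hC => ?_]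
    obtain ⟨y, -, rfl⟩ := (mem_children_iff o).1 hC
    exact card_block o n y
  rw [hconst, pow_succ, mul_pow, mul_comm] at hsum
  have hpos : 0 < (L ^ n) ^ d := by positivity
  exact (Nat.eq_of_mul_eq_mul_right hpos hsum).symm

end Blocks

/-! ### The level `h_σ(x,y)` of the minimal common block -/

section Level

variable {L : ℕ} (hL : 1 ≤ L) (o : ℕ → Site d)
include hL

/-- `x` and `y` lie in a common block (for the all-zero offsets two points in different orthants
never do: "there exist vertices with `d_σ(x,y) = h_σ(x,y) = ∞`; this will not cause us any
problems"). [cite: Hutchcroft2022, §2.1 (p. 6)] -/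
def HasCommonBlock (L : ℕ) (o : ℕ → Site d) (x y : Site d) : Prop := ∃ n, y ∈ block L o n x

open Classical in
/-- **`h_σ(x,y)`**: the minimal `n` such that some `n`-block contains `x` and `y` (junk value `0`
when there is none). [cite: Hutchcroft2022, §2.1 (p. 6, h_σ(x,y))] -/
def hLevel (L : ℕ) (o : ℕ → Site d) (x y : Site d) : ℕ :=
  if h : HasCommonBlock L o x y then Nat.find h else 0

omit hL in
/-- `y ∈ B_{h(x,y)}(x)` when a common block exists. [cite: Hutchcroft2022, §2.1 (p. 6)] -/
theorem mem_block_hLevel {x y : Site d} (h : HasCommonBlock L o x y) : y ∈ block L o (hLevel L o x y) x := by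
  rw [hLevel, dif_pos h]
  exact Nat.find_spec h

/-- **`y ∈ B_n(x)` iff `h_σ(x,y) ≤ n`** (and a common block exists). [cite: Hutchcroft2022, §2.1 (p. 6)] -/
theorem mem_block_iff_hLevel_le (ho : IsHierOffset L o) {n : ℕ} {x y : Site d} :
    y ∈ block L o n x ↔ HasCommonBlock L o x y ∧ hLevel L o x y ≤ n := by
  constructor
  · intro hy
    have h : HasCommonBlock L o x y := ⟨n, hy⟩
    refine ⟨h, ?_⟩
    rw [hLevel, dif_pos h]
    exact Nat.find_min' h hy
  · rintro ⟨h, hn⟩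
    exact block_mono hL o ho hn x (mem_block_hLevel o h)

omit hL in
/-- `HasCommonBlock` is symmetric. [folklore] -/
theorem HasCommonBlock.symm {x y : Site d} (h : HasCommonBlock L o x y) (hL : 1 ≤ L) :
    HasCommonBlock L o y x := by
  obtain ⟨n, hn⟩ := h
  exact ⟨n, by rw [(block_eq_iff_mem hL o).2 hn]; exact mem_block_self hL o n x⟩

/-- **`h_σ` is symmetric.** [cite: Hutchcroft2022, §2.1 (p. 6, d_σ is an ultrametric)] -/
theorem hLevel_comm (ho : IsHierOffset L o) (x y : Site d) : hLevel L o x y = hLevel L o y x := by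
  by_cases h : HasCommonBlock L o x y
  · have h' := h.symm o hL
    have h1 : y ∈ block L o (hLevel L o y x) x := by
      rw [(block_eq_iff_mem hL o).2 (mem_block_hLevel o h')]; exact mem_block_self hL o _ y
    have h2 : x ∈ block L o (hLevel L o x y) y := by
      rw [(block_eq_iff_mem hL o).2 (mem_block_hLevel o h)]; exact mem_block_self hL o _ x
    have := ((mem_block_iff_hLevel_le hL o ho).1 h1).2
    have := ((mem_block_iff_hLevel_le hL o ho).1 h2).2
    omega
  · have h' : ¬HasCommonBlock L o y x := fun h' => h (h'.symm o hL)
    rw [hLevel, hLevel, dif_neg h, dif_neg h']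

/-- `h_σ(x,x) = 0`. [cite: Hutchcroft2022, §2.1 (p. 6)] -/
theorem hLevel_self (x : Site d) : hLevel L o x x = 0 := by
  have h : HasCommonBlock L o x x := ⟨0, mem_block_self hL o 0 x⟩
  rw [hLevel, dif_pos h, Nat.find_eq_zero]
  exact mem_block_self hL o 0 x

/-- **`h_σ(x,y) ≥ 1` for `x ≠ y`** (`0`-blocks are singletons). [cite: Hutchcroft2022, §2.1 (p. 6)] -/
theorem one_le_hLevel {x y : Site d} (hxy : x ≠ y) (h : HasCommonBlock L o x y) : 1 ≤ hLevel L o x y := by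
  by_contra h0
  push Not at h0
  have : hLevel L o x y = 0 := by omega
  have hy := mem_block_hLevel o h
  rw [this, block_zero hL o] at hy
  exact hxy (Finset.mem_singleton.1 hy).symm

/-- **`‖x - y‖_∞ < L^{h_σ(x,y)}`** ("`d_σ(x,y) ≥ ‖x-y‖`"). [cite: Hutchcroft2022, §2.1 (p. 6)] -/
theorem dist_lt_pow_hLevel {x y : Site d} (h : HasCommonBlock L o x y) :
    dist x y < (L : ℝ) ^ hLevel L o x y := by
  have hy := mem_block_hLevel o h
  have hL0 : (0 : ℝ) < (L : ℝ) ^ hLevel L o x y := by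
    have : (0 : ℝ) < L := by exact_mod_cast hL
    positivity
  rw [dist_pi_lt_iff hL0]
  intro i
  rw [Int.dist_eq]
  have := abs_sub_lt_of_mem_block hL o hy i
  exact_mod_cast this

end Level

/-! ### Translations of the decomposition -/

section Shift

variable {L : ℕ} (hL : 1 ≤ L)
include hL

/-- **The translated decomposition `σ + t`** ((2.2): "`ℬ^{σ+x}_n = {B + x : B ∈ ℬ^σ_n}`"): shift the
offsets by `t` modulo `L^n`. [cite: Hutchcroft2022, §2.1 (2.2)] -/
def shiftOffset (L : ℕ) (o : ℕ → Site d) (t : Site d) : ℕ → Site d :=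
  fun n i => (o n i + t i) % (L : ℤ) ^ n

/-- Translation preserves compatibility of the offsets. [cite: Hutchcroft2022, §2.1 (2.2)] -/
theorem IsHierOffset.shift {o : ℕ → Site d} (ho : IsHierOffset L o) (t : Site d) :
    IsHierOffset L (shiftOffset L o t) := by
  intro n i
  have hpos : (0 : ℤ) < (L : ℤ) ^ n := by
    have : (0 : ℤ) < L := by exact_mod_cast hL
    positivity
  refine ⟨Int.emod_nonneg _ hpos.ne', Int.emod_lt_of_pos _ hpos, ?_⟩
  show (o (n + 1) i + t i) % (L : ℤ) ^ (n + 1) % (L : ℤ) ^ n = (o n i + t i) % (L : ℤ) ^ n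
  rw [Int.emod_emod_of_dvd _ (pow_dvd_pow (L : ℤ) (Nat.le_succ n)), Int.add_emod (o (n + 1) i),
    ho.succ_emod]
  conv_rhs => rw [Int.add_emod, Int.emod_eq_of_lt (ho.nonneg n i) (ho.lt n i)]

/-- **Blocks of the translated decomposition are translated blocks**: `y ∈ B^{σ+t}_n(x) ↔ y - t ∈
B^σ_n(x - t)`. [cite: Hutchcroft2022, §2.1 (2.2)] -/
theorem mem_block_shift_iff (o : ℕ → Site d) (t : Site d) {n : ℕ} {x y : Site d} :
    y ∈ block L (shiftOffset L o t) n x ↔ y - t ∈ block L o n (x - t) := by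
  have hpos : (0 : ℤ) < (L : ℤ) ^ n := by
    have : (0 : ℤ) < L := by exact_mod_cast hL
    positivity
  rw [mem_block_iff hL, mem_block_iff hL]
  have key : ∀ z : Site d, blockIdx L (shiftOffset L o t) n z =
      fun i => blockIdx L o n (z - t) i + (o n i + t i) / (L : ℤ) ^ n := by
    intro z
    funext i
    simp only [blockIdx, shiftOffset, Pi.sub_apply]
    have h1 := Int.mul_ediv_add_emod (o n i + t i) ((L : ℤ) ^ n)
    have : z i - (o n i + t i) % (L : ℤ) ^ n =
        (z i - t i - o n i) + ((o n i + t i) / (L : ℤ) ^ n) * (L : ℤ) ^ n := by linarith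
    rw [this, Int.add_mul_ediv_right _ _ hpos.ne']
  rw [key, key]
  constructor
  · intro h
    funext i
    have := congr_fun h i
    exact add_right_cancel this
  · intro h
    funext i
    show blockIdx L o n (y - t) i + _ = blockIdx L o n (x - t) i + _
    rw [show blockIdx L o n (y - t) i = blockIdx L o n (x - t) i from congr_fun h i]

/-- The translated block as an image: `B^{σ+t}_n(x + t) = B^σ_n(x) + t`. [cite: Hutchcroft2022, §2.1 (2.2)] -/
theorem block_shift_eq_image (o : ℕ → Site d) (t : Site d) (n : ℕ) (x : Site d) :
    block L (shiftOffset L o t) n (x + t) = (block L o n x).image (· + t) := by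
  ext y
  rw [mem_block_shift_iff hL, Finset.mem_image, add_sub_cancel_right]
  constructor
  · intro h; exact ⟨y - t, h, sub_add_cancel y t⟩
  · rintro ⟨z, hz, rfl⟩; rwa [add_sub_cancel_right]

/-- `h_{σ+t}(x + t, y + t) = h_σ(x, y)` (translation covariance, (2.3)). [cite: Hutchcroft2022, §2.1 (2.3)] -/
theorem hLevel_shift (o : ℕ → Site d) (t x y : Site d) :
    hLevel L (shiftOffset L o t) (x + t) (y + t) = hLevel L o x y := by
  have hiff : ∀ n, y + t ∈ block L (shiftOffset L o t) n (x + t) ↔ y ∈ block L o n x := by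
    intro n
    rw [mem_block_shift_iff hL, add_sub_cancel_right, add_sub_cancel_right]
  have hcommon : HasCommonBlock L (shiftOffset L o t) (x + t) (y + t) ↔ HasCommonBlock L o x y := by
    simp only [HasCommonBlock, hiff]
  by_cases h : HasCommonBlock L o x y
  · rw [hLevel, hLevel, dif_pos (hcommon.2 h), dif_pos h]
    exact Nat.find_congr' fun {n} => hiff n
  · rw [hLevel, hLevel, dif_neg (fun h' => h (hcommon.1 h')), dif_neg h]

end Shift

/-! ### The hierarchical kernel `H_σ` and the remainder `R_σ = J - H_σ` -/

section Kernels

variable {L : ℕ} (hL : 1 ≤ L) {o : ℕ → Site d}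

/-- The symmetrised level used to define the kernels without hypotheses (equal to `h_σ(x,y)` for a
genuine decomposition, `hLevelSym_eq`). [folklore] -/
def hLevelSym (L : ℕ) (o : ℕ → Site d) (x y : Site d) : ℕ := min (hLevel L o x y) (hLevel L o y x)

omit hL in
/-- `hLevelSym` is symmetric by construction. [folklore] -/
theorem hLevelSym_comm (L : ℕ) (o : ℕ → Site d) (x y : Site d) : hLevelSym L o x y = hLevelSym L o y x :=
  min_comm _ _

include hL in
/-- `hLevelSym = h_σ`. [folklore] -/
theorem hLevelSym_eq (ho : IsHierOffset L o) (x y : Site d) : hLevelSym L o x y = hLevel L o x y := by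
  rw [hLevelSym, ← hLevel_comm hL o ho x y, min_self]

open Classical in
/-- **The hierarchical kernel** `H_σ(x,y) = c d_σ(x,y)^{-d-α} = c L^{-(d+α) h_σ(x,y)}` for `x ≠ y`
in a common block, and `0` otherwise (in particular on the diagonal and when `d_σ = ∞`).
[cite: Hutchcroft2022, §2.1 (p. 6, H_σ)] -/
def hierKernel (L : ℕ) (o : ℕ → Site d) (c α : ℝ) : Sym2 (Site d) → ℝ :=
  Sym2.lift ⟨fun x y => if x ≠ y ∧ (HasCommonBlock L o x y ∨ HasCommonBlock L o y x) then
      c * ((L : ℝ) ^ hLevelSym L o x y) ^ (-((d : ℝ) + α)) else 0, by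
    intro x y
    have h1 : (x ≠ y ∧ (HasCommonBlock L o x y ∨ HasCommonBlock L o y x)) ↔
        (y ≠ x ∧ (HasCommonBlock L o y x ∨ HasCommonBlock L o x y)) := by
      rw [ne_comm, or_comm]
    dsimp only
    rw [hLevelSym_comm L o x y]
    by_cases h : x ≠ y ∧ (HasCommonBlock L o x y ∨ HasCommonBlock L o y x)
    · rw [if_pos h, if_pos (h1.1 h)]
    · rw [if_neg h, if_neg (fun h' => h (h1.2 h'))]⟩

include hL in
open Classical in
/-- The value of `H_σ` on a pair. [cite: Hutchcroft2022, §2.1 (p. 6, H_σ)] -/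
theorem hierKernel_mk (ho : IsHierOffset L o) (c α : ℝ) (x y : Site d) :
    hierKernel L o c α s(x, y) = if x ≠ y ∧ HasCommonBlock L o x y then
      c * ((L : ℝ) ^ hLevel L o x y) ^ (-((d : ℝ) + α)) else 0 := by
  have hiff : (x ≠ y ∧ (HasCommonBlock L o x y ∨ HasCommonBlock L o y x)) ↔
      (x ≠ y ∧ HasCommonBlock L o x y) :=
    ⟨fun h => ⟨h.1, h.2.elim id fun h' => h'.symm o hL⟩, fun h => ⟨h.1, Or.inl h.2⟩⟩
  simp only [hierKernel, Sym2.lift_mk, hLevelSym_eq hL ho]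
  by_cases h : x ≠ y ∧ HasCommonBlock L o x y
  · rw [if_pos (hiff.2 h), if_pos h]
  · rw [if_neg (fun h' => h (hiff.1 h')), if_neg h]

/-- `H_σ` vanishes on the diagonal. [cite: Hutchcroft2022, §2.1 (p. 6)] -/
theorem hierKernel_diag (c α : ℝ) (x : Site d) : hierKernel L o c α s(x, x) = 0 := by
  simp [hierKernel]

/-- `H_σ ≥ 0` for `c ≥ 0`. [cite: Hutchcroft2022, §2.1 (p. 6)] -/
theorem hierKernel_nonneg {c : ℝ} (hc : 0 ≤ c) (α : ℝ) (e : Sym2 (Site d)) : 0 ≤ hierKernel L o c α e := by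
  induction e using Sym2.ind with
  | h x y =>
    simp only [hierKernel, Sym2.lift_mk]
    split_ifs
    · exact mul_nonneg hc (Real.rpow_nonneg (by positivity) _)
    · exact le_rfl

include hL in
/-- **`H_σ ≤ J`** under the power-law lower bound: "`J(x,y) ≥ c‖x-y‖^{-d-α} ≥ c d_σ(x,y)^{-d-α}`
for every pair of distinct points", i.e. **the remainder `R_σ = J - H_σ` is nonnegative**.
[cite: Hutchcroft2022, §2.1 (p. 6, non-negativity of R_σ)] -/
theorem hierKernel_le (ho : IsHierOffset L o) {J : Sym2 (Site d) → ℝ} {c α : ℝ} (hc : 0 ≤ c)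
    (hα : 0 ≤ (d : ℝ) + α) (hJ0 : ∀ e, 0 ≤ J e) (hJ : HasPowerLowerBound J c α) (e : Sym2 (Site d)) :
    hierKernel L o c α e ≤ J e := by
  induction e using Sym2.ind with
  | h x y =>
    rw [hierKernel_mk hL ho]
    split_ifs with h
    · obtain ⟨hxy, hcommon⟩ := h
      refine le_trans ?_ (hJ x y hxy)
      refine mul_le_mul_of_nonneg_left ?_ hc
      -- `L^h > dist x y > 0` and the exponent is nonpositive
      have hdist : 0 < dist x y := dist_pos.2 hxy
      exact Real.rpow_le_rpow_of_nonpos hdist (dist_lt_pow_hLevel hL o hcommon).le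
        (neg_nonpos.2 hα)
    · exact hJ0 _

/-- **The remainder kernel `R_σ = J - H_σ`.** [cite: Hutchcroft2022, §2.1 (p. 6, R_σ)] -/
def remKernel (J : Sym2 (Site d) → ℝ) (L : ℕ) (o : ℕ → Site d) (c α : ℝ) : Sym2 (Site d) → ℝ :=
  fun e => J e - hierKernel L o c α e

include hL in
/-- `R_σ ≥ 0`. [cite: Hutchcroft2022, §2.1 (p. 6)] -/
theorem remKernel_nonneg (ho : IsHierOffset L o) {J : Sym2 (Site d) → ℝ} {c α : ℝ} (hc : 0 ≤ c)
    (hα : 0 ≤ (d : ℝ) + α) (hJ0 : ∀ e, 0 ≤ J e) (hJ : HasPowerLowerBound J c α) (e : Sym2 (Site d)) :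
    0 ≤ remKernel J L o c α e :=
  sub_nonneg.2 (hierKernel_le hL ho hc hα hJ0 hJ e)

/-- `J = H_σ + R_σ`. [cite: Hutchcroft2022, §2.1 (p. 6, "J(x,y) = H_σ(x,y) + R_σ(x,y)")] -/
theorem hierKernel_add_remKernel (J : Sym2 (Site d) → ℝ) (L : ℕ) (o : ℕ → Site d) (c α : ℝ)
    (e : Sym2 (Site d)) : hierKernel L o c α e + remKernel J L o c α e = J e := by
  simp [remKernel]

/-! ### The block kernels `H_B` -/

open Classical in
/-- **The kernel `H_B` of the block `B = B_n(x)`** (`n ≥ 1`): `H_B(a,b) = c L^{-(d+α)n} 𝟙(a, b ∈ B,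
h_σ(a,b) = n)`. [cite: Hutchcroft2022, §2.1 (p. 6, H_B)] -/
def blockKernel (L : ℕ) (o : ℕ → Site d) (c α : ℝ) (n : ℕ) (x : Site d) : Sym2 (Site d) → ℝ :=
  Sym2.lift ⟨fun a b => if a ∈ block L o n x ∧ b ∈ block L o n x ∧ a ≠ b ∧ hLevelSym L o a b = n then
      c * ((L : ℝ) ^ n) ^ (-((d : ℝ) + α)) else 0, by
    intro a b
    dsimp only
    have hiff : (a ∈ block L o n x ∧ b ∈ block L o n x ∧ a ≠ b ∧ hLevelSym L o a b = n) ↔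
        (b ∈ block L o n x ∧ a ∈ block L o n x ∧ b ≠ a ∧ hLevelSym L o b a = n) := by
      rw [hLevelSym_comm L o a b, ne_comm]; tauto
    by_cases h : a ∈ block L o n x ∧ b ∈ block L o n x ∧ a ≠ b ∧ hLevelSym L o a b = n
    · rw [if_pos h, if_pos (hiff.1 h)]
    · rw [if_neg h, if_neg (fun h' => h (hiff.2 h'))]⟩

include hL in
/-- **`H_σ = Σ_{n ≥ 1} Σ_{B ∈ ℬ_n} H_B`**, edge by edge: the only block kernel charging the pair
`{a, b}` (`a ≠ b` in a common block) is that of `B_{h(a,b)}(a)`, where it equals `H_σ(a,b)`.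
[cite: Hutchcroft2022, §2.1 (p. 6, "H_σ(x,y) = Σ_{n≥1} Σ_{B∈ℬ_n^σ} H_B(x,y)")] -/
theorem blockKernel_eq_hierKernel (ho : IsHierOffset L o) (c α : ℝ) {a b : Site d} (hab : a ≠ b)
    (hcommon : HasCommonBlock L o a b) :
    blockKernel L o c α (hLevel L o a b) a s(a, b) = hierKernel L o c α s(a, b) := by
  rw [hierKernel_mk hL ho, if_pos ⟨hab, hcommon⟩]
  simp only [blockKernel, Sym2.lift_mk]
  rw [if_pos ⟨mem_block_self hL o _ a, mem_block_hLevel o hcommon, hab, hLevelSym_eq hL ho a b⟩]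

include hL in
/-- Any other block kernel vanishes on `{a, b}`: `H_{B_n(x)}(a,b) ≠ 0` forces `n = h(a,b)` and
`B_n(x) = B_{h(a,b)}(a)`. [cite: Hutchcroft2022, §2.1 (p. 6)] -/
theorem blockKernel_eq_zero_of_ne (ho : IsHierOffset L o) (c α : ℝ) {n : ℕ} {x a b : Site d}
    (h : block L o n x ≠ block L o (hLevel L o a b) a ∨ n ≠ hLevel L o a b) :
    blockKernel L o c α n x s(a, b) = 0 := by
  simp only [blockKernel, Sym2.lift_mk, hLevelSym_eq hL ho]
  rw [if_neg]
  rintro ⟨ha, -, -, hn⟩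
  rcases h with h | h
  · subst hn
    exact h ((block_eq_iff_mem hL o).2 ha).symm
  · exact h hn.symm

/-- `H_B ≥ 0`. [cite: Hutchcroft2022, §2.1 (p. 6)] -/
theorem blockKernel_nonneg {c : ℝ} (hc : 0 ≤ c) (α : ℝ) (n : ℕ) (x : Site d) (e : Sym2 (Site d)) :
    0 ≤ blockKernel L o c α n x e := by
  induction e using Sym2.ind with
  | h a b =>
    simp only [blockKernel, Sym2.lift_mk]
    split_ifs
    · exact mul_nonneg hc (Real.rpow_nonneg (by positivity) _)
    · exact le_rfl

/-- `H_B ≤ c L^{-(d+α)n}` pointwise ("any two vertices of `B_m` are connected by an edge of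
`ω_{B_m}` with probability at most `cβL^{-(d+α)m}`"). [cite: Hutchcroft2022, proof of Lemma 2.10 (p. 12)] -/
theorem blockKernel_le {c : ℝ} (hc : 0 ≤ c) (α : ℝ) (n : ℕ) (x : Site d) (e : Sym2 (Site d)) :
    blockKernel L o c α n x e ≤ c * ((L : ℝ) ^ n) ^ (-((d : ℝ) + α)) := by
  induction e using Sym2.ind with
  | h a b =>
    simp only [blockKernel, Sym2.lift_mk]
    split_ifs
    · exact le_rfl
    · exact mul_nonneg hc (Real.rpow_nonneg (by positivity) _)

end Kernels

end Literature.Probability.Percolation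

end
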